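import Summits.KontsevichZagierPeriods.KontsevichZagierPeriods.Theorems.FurushoPentagonHoffmanRelationInKZStuffleDissection

/-!
# `DoubleShuffleInKZ` (stmt-KontsevichZagierPeriods-14665, route `FurushoPentagon`): the rider dissection, domains

Helper file (`--supports stmt-KontsevichZagierPeriods-14665`), line "rider lever" for the
Kaneko–Yamamoto integral–series family `IS_j(u)`.  THE MIXED REPRESENTATIONS of the line: for an
admissible index `w'` (weight `n'`, cubical integrand `f_{w'}`), a block `m'` (first slot
`q' = p_{m'}`) and `j` RIDERS, the representation `C_j(w', m')` has domain

  `{(v, x) ∈ ℝʲ × ℝⁿ' | x ∈ (0,1)ⁿ', 0 < v₀ < v₁ < ⋯ < v_{j-1} < 1, v_{j-1} < x_{q'}}`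

(riders first, increasing, the top rider adjacent to and below the cubical coordinate `x_{q'}`) and
integrand `f_{w'}(x) · ∏_a 1/(1 − v_a)` — the cubical word integrand with an unfolded chain
`Li_{1,…,1}` hanging below `x_{q'}`.

This file: the DOMAIN bookkeeping of the rider dissection (`rider_dissection`, sibling file
`FurushoPentagonDoubleShuffleInKZRiderDissection.lean`) — reading a point `(v₀,…,v_j, x)` of the END
domain `{x ∈ (0,1)ⁿ, 0 < v₀ < ⋯ < v_j < 1}` along the coordinate permutation that keeps the riders
`v₀,…,v_{j-1}` and moves the top rider `v_j` into slot `P` of the cubical block lands exactly in the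
mixed domain of a word of weight `n + 1` whose distinguished block starts at `P`
(`piece_domain_eq`); and the END domain is `ℚ`-semialgebraic (`isSemialgebraic_endDomain`).

References: M. Kontsevich, D. Zagier, *Periods* (2001), §1.2; K. Ihara, M. Kaneko, D. Zagier,
Compos. Math. 142 (2006), Thm 2; M. Kaneko, S. Yamamoto, Selecta Math. 24 (2018), Thm 4.1.
-/

noncomputable section

open Set MeasureTheory Finset
open Literature.NumberTheory.Transcendental
open Summit.KontsevichZagierPeriods.FurushoPentagon.HoffmanRelationInKZ

namespace Summit.KontsevichZagierPeriods.FurushoPentagon.DoubleShuffleInKZ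

/-! ### The domain of a piece read along the block permutation -/

/-- A property of all `y (P.cycleRange (cast t))`, `t : Fin N`, is a property of all `y s`.
[folklore] -/
theorem forall_comp_cycleRange_iff {N n : ℕ} (hw : N = n + 1) (P : Fin (n + 1))
    (Q : Fin (n + 1) → Prop) :
    (∀ t : Fin N, Q (P.cycleRange (Fin.cast hw t))) ↔ ∀ s : Fin (n + 1), Q s := by
  constructor
  · intro h s
    simpa using h (Fin.cast hw.symm (P.cycleRange.symm s))
  · intro h t
    exact h _

/-- **The domain of a piece is the END domain.** Reading a point `z = (v₀,…,v_j, x) ∈ ℝ^{(j+1)+n}`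
along an equivalence `E` which keeps the first `j` riders and moves the top rider `v_j` into slot
`P` of the cubical block, the mixed domain with `j` riders of a word of weight `n + 1` whose block
`m'` starts at `P` pulls back to `{x ∈ (0,1)ⁿ, 0 < v₀ < ⋯ < v_j < 1}`. [folklore] -/
theorem piece_domain_eq {j n : ℕ} (w' : List ℕ) (m' : ℕ) (hw' : MZV.weight w' = n + 1)
    (P : Fin (n + 1)) (hP : (P : ℕ) = (w'.take m').sum) (hjn : j + (n + 1) = (j + 1) + n)
    (E : Fin (j + MZV.weight w') ≃ Fin ((j + 1) + n))
    (hE1 : ∀ a : Fin j, E (Fin.castAdd _ a) = Fin.castAdd n (Fin.castSucc a))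
    (hE2 : ∀ t : Fin (MZV.weight w'),
      E (Fin.natAdd j t) = Fin.cast hjn (Fin.natAdd j (P.cycleRange (Fin.cast hw' t)))) :
    {z : Fin ((j + 1) + n) → ℝ | (fun idx => z (E idx)) ∈
      {z : Fin (j + MZV.weight w') → ℝ |
        (∀ i : Fin (MZV.weight w'), z (Fin.natAdd j i) ∈ Set.Ioo (0:ℝ) 1) ∧
        (∀ a : Fin j, z (Fin.castAdd (MZV.weight w') a) ∈ Set.Ioo (0:ℝ) 1) ∧
        (∀ a b : Fin j, a < b → z (Fin.castAdd (MZV.weight w') a) < z (Fin.castAdd (MZV.weight w') b)) ∧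
        (∀ a : Fin j, (a : ℕ) + 1 = j → ∀ i : Fin (MZV.weight w'), (i : ℕ) = (w'.take m').sum →
          z (Fin.castAdd (MZV.weight w') a) < z (Fin.natAdd j i))}} =
    {z : Fin ((j + 1) + n) → ℝ |
      (∀ i : Fin n, z (Fin.natAdd (j + 1) i) ∈ Set.Ioo (0:ℝ) 1) ∧
      (∀ a : Fin (j + 1), z (Fin.castAdd n a) ∈ Set.Ioo (0:ℝ) 1) ∧
      (∀ a b : Fin (j + 1), a < b → z (Fin.castAdd n a) < z (Fin.castAdd n b))} := by
  -- coordinates of the block `(v_j, x)`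
  have h0 : (Fin.cast hjn (Fin.natAdd j (0 : Fin (n + 1))) : Fin ((j + 1) + n)) =
      Fin.castAdd n (Fin.last j) := by ext; simp
  have hs : ∀ t : Fin n, (Fin.cast hjn (Fin.natAdd j t.succ) : Fin ((j + 1) + n)) =
      Fin.natAdd (j + 1) t := by intro t; ext; simp; omega
  -- the slot `P` as an element of `Fin (weight w')`
  have hPlt : (P : ℕ) < MZV.weight w' := by rw [hw']; exact P.2
  have hcastP : Fin.cast hw' ⟨P, hPlt⟩ = P := Fin.ext rfl
  ext z
  simp only [Set.mem_setOf_eq, hE1, hE2]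
  rw [forall_comp_cycleRange_iff hw' P (fun s => z (Fin.cast hjn (Fin.natAdd j s)) ∈ Set.Ioo (0:ℝ) 1),
    Fin.forall_fin_succ, h0]
  simp only [hs]
  constructor
  · rintro ⟨⟨htop, hx⟩, hv, hmono, hlast⟩
    have hlast' : ∀ a : Fin j, (a : ℕ) + 1 = j →
        z (Fin.castAdd n (Fin.castSucc a)) < z (Fin.castAdd n (Fin.last j)) := by
      intro a ha
      have h := hlast a ha ⟨P, hPlt⟩ hP
      rwa [hcastP, Fin.cycleRange_self, h0] at h
    refine ⟨hx, fun a => ?_, fun a b hab => ?_⟩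
    · refine Fin.lastCases htop (fun a => hv a) a
    · -- strict monotonicity on all `j + 1` riders
      induction b using Fin.lastCases with
      | last =>
        induction a using Fin.lastCases with
        | last => exact absurd hab (lt_irrefl _)
        | cast a =>
          by_cases ha : (a : ℕ) + 1 = j
          · exact hlast' a ha
          · have hj : (a : ℕ) + 1 < j := lt_of_le_of_ne (Nat.succ_le_of_lt a.2) ha
            have h1 := hmono a ⟨j - 1, by omega⟩ (by rw [Fin.lt_def]; simp; omega)
            have h2 := hlast' ⟨j - 1, by omega⟩ (by simp; omega)
            exact h1.trans h2
      | cast b =>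
        induction a using Fin.lastCases with
        | last =>
          have h : (b.castSucc : Fin (j + 1)) ≤ Fin.last j := Fin.le_last _
          exact absurd hab (not_lt.mpr h)
        | cast a =>
          have hab' : a < b := by rwa [Fin.lt_def, Fin.val_castSucc, Fin.val_castSucc] at hab
          exact hmono a b hab'
  · rintro ⟨hx, hv, hmono⟩
    refine ⟨⟨hv (Fin.last j), hx⟩, fun a => hv (Fin.castSucc a), fun a b hab => ?_, fun a ha i hi => ?_⟩
    · exact hmono _ _ (by rwa [Fin.lt_def, Fin.val_castSucc, Fin.val_castSucc])
    · have hiP : Fin.cast hw' i = P := Fin.ext (by rw [Fin.val_cast, hi, hP])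
      rw [hiP, Fin.cycleRange_self, h0]
      exact hmono _ _ (by rw [Fin.lt_def, Fin.val_castSucc, Fin.val_last]; omega)

/-! ### The END domain is semialgebraic -/

/-- The END domain `{x ∈ (0,1)ⁿ, 0 < v₀ < ⋯ < v_j < 1}` (riders first) is `ℚ`-semialgebraic
(finitely many strict polynomial inequalities). [folklore] -/
theorem isSemialgebraic_endDomain (J n : ℕ) :
    Literature.ModelTheory.ExponentialFields.IsSemialgebraic ℚ {z : Fin (J + n) → ℝ |
      (∀ i : Fin n, z (Fin.natAdd J i) ∈ Set.Ioo (0:ℝ) 1) ∧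
      (∀ a : Fin J, z (Fin.castAdd n a) ∈ Set.Ioo (0:ℝ) 1) ∧
      (∀ a b : Fin J, a < b → z (Fin.castAdd n a) < z (Fin.castAdd n b))} := by
  have h1 : Literature.ModelTheory.ExponentialFields.IsSemialgebraic ℚ
      {z : Fin (J + n) → ℝ | ∀ k, 0 < z k ∧ z k < 1} := by
    have : {z : Fin (J + n) → ℝ | ∀ k, 0 < z k ∧ z k < 1} =
        ⋂ k ∈ (Finset.univ : Finset (Fin (J + n))),
          ({z | 0 < MvPolynomial.aeval z (MvPolynomial.X k : MvPolynomial (Fin (J + n)) ℚ)} ∩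
           {z | 0 < MvPolynomial.aeval z
             (MvPolynomial.C 1 - MvPolynomial.X k : MvPolynomial (Fin (J + n)) ℚ)}) := by
      ext z; simp [sub_pos]
    rw [this]
    exact Literature.ModelTheory.ExponentialFields.IsSemialgebraic.biInter _ _ fun k _ =>
      (Literature.ModelTheory.ExponentialFields.isSemialgebraic_setOf_eval_pos _).inter
        (Literature.ModelTheory.ExponentialFields.isSemialgebraic_setOf_eval_pos _)
  have h2 : Literature.ModelTheory.ExponentialFields.IsSemialgebraic ℚ
      {z : Fin (J + n) → ℝ | ∀ a b : Fin J, a < b → z (Fin.castAdd n a) < z (Fin.castAdd n b)} := by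
    have : {z : Fin (J + n) → ℝ | ∀ a b : Fin J, a < b → z (Fin.castAdd n a) < z (Fin.castAdd n b)} =
        ⋂ a ∈ (Finset.univ : Finset (Fin J)), ⋂ b ∈ (Finset.univ : Finset (Fin J)),
          (if a < b then {z | 0 < MvPolynomial.aeval z
            (MvPolynomial.X (Fin.castAdd n b) - MvPolynomial.X (Fin.castAdd n a) :
              MvPolynomial (Fin (J + n)) ℚ)} else Set.univ) := by
      ext z
      simp only [Set.mem_setOf_eq, Finset.mem_univ, Set.iInter_true, Set.mem_iInter]
      constructor
      · intro h a b
        split_ifs with hab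
        · simpa [sub_pos] using h a b hab
        · trivial
      · intro h a b hab
        have := h a b
        rw [if_pos hab] at this
        simpa [sub_pos] using this
    rw [this]
    refine Literature.ModelTheory.ExponentialFields.IsSemialgebraic.biInter _ _ fun a _ =>
      Literature.ModelTheory.ExponentialFields.IsSemialgebraic.biInter _ _ fun b _ => ?_
    split_ifs
    · exact Literature.ModelTheory.ExponentialFields.isSemialgebraic_setOf_eval_pos _
    · exact Literature.ModelTheory.ExponentialFields.isSemialgebraic_univ
  convert h1.inter h2 using 1
  ext z
  simp only [Set.mem_setOf_eq, Set.mem_inter_iff, Set.mem_Ioo]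
  constructor
  · rintro ⟨hx, hv, hmono⟩
    refine ⟨fun k => ?_, hmono⟩
    refine Fin.addCases (fun a => hv a) (fun i => hx i) k
  · rintro ⟨h, hmono⟩
    exact ⟨fun i => h _, fun a => h _, hmono⟩

end Summit.KontsevichZagierPeriods.FurushoPentagon.DoubleShuffleInKZ
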